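import Summits.Ventures.WeilGRH.TwistedGramEntryBox
import Summits.Ventures.WeilGRH.TwistedGramCoeffCReal
import HarnessLib

/-!
# GRH arm (rh-explicit, venture WeilGRH): twisted format C for COMPLEX characters — the kernel ENTRY BOX of `Re G^χ(n,m)`
  (second entry brick of the complex χ-cell lane: the table `M(κ p, κ p') = (twistedGramCoeffC χ a p p').re` of the door `_dataJ`, boxed)

Cell `rh-explicit`, WEIL TRACK — GRH ARM (engine seat weil-grh-2 gen10).  The complex data door
`weilPositivityOnChar_of_twistedC_formatC_dataJ` (`TwistedComplexDataRungJ.lean`) consumes a real symmetric table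
`M i i' = (twistedGramCoeffC χ a p p').re` on the enumeration `κ`.  By `TwistedGramCoeffCReal.lean` (weil-grh-5):
off the diagonal `Re G^χ(n,m) = (−1)^{n+m}(F_m − F_n)/(π(m−n))` with
`F_p = ½ Im ψ(¼+iω_p/2) + Σ_k Λ(k)k^{-1/2}(Re χ(k) sin(ω_p log k) + Im χ(k) cos(ω_p log k)) − T_p`, and on the diagonal
(this file, from `re_twistedGramCoeffC` + `gramCoeff = polar + prime + arch`)
`Re G^χ(n,n) = archCoeff(n,n) + log q − Σ_k Λ(k)k^{-1/2}(2 − log k/a)(Re χ(k) cos(ω_n log k) − Im χ(k) sin(ω_n log k))`.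
So the complex entry box is the REAL one (`TwistedGramEntryBox.lean`, integer weights `ε_i = Re χ(k_i)`) with the weights
replaced by two interval lists `xs ∋ Re χ(k_i)`, `ys ∋ Im χ(k_i)` and one extra sine/cosine term per prime power — no new
transcendental input; the SAME certified special-value tables (`Encl.IdxRec`, `checkTable`) serve every character:
`primeSumC` / `primeDiagSumC` (the χ-weighted prime sums), `twistedGramCBox`, ★ `mem_twistedGramCBox` (soundness).
Everything is PROVED; computable `def`s; RH/GRH-free.  References: H. Yoshida (1992) §5 (5.15)/(5.16) p. 301
[Yoshida1992HermitianForms]; R. E. Moore (1966) Ch. 3 [Moore1966]; A. Weil (1952) (11) [Weil1952FormulesExplicites].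
-/

set_option autoImplicit false
set_option linter.style.longLine false

open Real Complex Finset
open scoped BigOperators ArithmeticFunction.vonMangoldt ComplexConjugate

namespace Summit.Ventures.WeilGRH

open Literature.NumberTheory.LFunctions Literature.NumberTheory.LFunctions.Yoshida1992
open Literature.NumberTheory.LFunctions.Yoshida1992.Encl
open Literature.Analysis.SpecialFunctions Literature.Analysis.ValidatedNumerics.NumericsMP

namespace TwistedEncl

variable {S : ℕ} {a : ℝ} {q : ℕ}

/-! ## The χ-weighted prime sums -/

/-- `Σ_{i<k} wt_i · (x_i · Im cs_i + y_i · Re cs_i)` — the prime part of `F_p` (`x_i ∋ Re χ(k_i)`, `y_i ∋ Im χ(k_i)`,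
`cs_i ∋ e^{iω_p ℓ_i}`). [cite: Yoshida1992HermitianForms, §5 (5.16) p. 301] -/
def primeSumC (S : ℕ) (xs ys wts : List MI) (cs : List MC) : ℕ → MI
  | 0 => MI.ofInt S 0
  | i + 1 => (primeSumC S xs ys wts cs i).add
      ((wts.getD i default).mul S (((xs.getD i default).mul S (cs.getD i default).im).add
        ((ys.getD i default).mul S (cs.getD i default).re)))

/-- `Σ_{i<k} wt_i · w_i · (x_i · Re cs_i − y_i · Im cs_i)` — the diagonal prime sum (`w_i ∋ 2 − ℓ_i/a`).
[cite: Yoshida1992HermitianForms, §5 (5.15) p. 301] -/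
def primeDiagSumC (S : ℕ) (xs ys wts ws : List MI) (cs : List MC) : ℕ → MI
  | 0 => MI.ofInt S 0
  | i + 1 => (primeDiagSumC S xs ys wts ws cs i).add
      (((wts.getD i default).mul S (ws.getD i default)).mul S (((xs.getD i default).mul S (cs.getD i default).re).sub
        ((ys.getD i default).mul S (cs.getD i default).im)))

/-- `primeSumC` encloses `Σ_{i<k} Λ_i (Re χ(k_i) sin(ω_p ℓ_i) + Im χ(k_i) cos(ω_p ℓ_i))`.
[cite: Moore1966, Ch. 3 (interval arithmetic: inclusion property)] -/
theorem mem_primeSumC (hS : 0 < S) {ks : List PrimeLen} {C : Consts} (hC : ConstsValid S a ks C)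
    (χ : DirichletCharacter ℂ q) {xs ys : List MI}
    (hx : ∀ i < ks.length, MI.mem S (χ (((ks.getD i default).val : ℕ) : ZMod q)).re (xs.getD i default))
    (hy : ∀ i < ks.length, MI.mem S (χ (((ks.getD i default).val : ℕ) : ZMod q)).im (ys.getD i default))
    {p : ℤ} {R : IdxRec} (hR : OffValid S a ks p R) :
    ∀ k, k ≤ ks.length → MI.mem S (∑ i ∈ Finset.range k,
      (ks.getD i default).wt * ((χ (((ks.getD i default).val : ℕ) : ZMod q)).re * Real.sin (freq a p * (ks.getD i default).len) +
        (χ (((ks.getD i default).val : ℕ) : ZMod q)).im * Real.cos (freq a p * (ks.getD i default).len)))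
      (primeSumC S xs ys C.wts R.cs k)
  | 0, _ => by simpa [primeSumC] using MI.mem_ofInt S 0
  | k + 1, hk => by
      rw [Finset.sum_range_succ, primeSumC]
      have hk' : k < ks.length := hk
      have hcos : MI.mem S (Real.cos (freq a p * (ks.getD k default).len)) (R.cs.getD k default).re := by
        have := (hR.cs k hk').1
        rwa [Complex.exp_ofReal_mul_I_re] at this
      have hsin : MI.mem S (Real.sin (freq a p * (ks.getD k default).len)) (R.cs.getD k default).im := by
        have := (hR.cs k hk').2
        rwa [Complex.exp_ofReal_mul_I_im] at this
      refine MI.mem_add (mem_primeSumC hS hC χ hx hy hR k (by omega)) ?_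
      exact mem_of_eq (MI.mem_mul hS (hC.wts k hk') (MI.mem_add (MI.mem_mul hS (hx k hk') hsin)
        (MI.mem_mul hS (hy k hk') hcos))) (by ring)

/-- `primeDiagSumC` encloses `Σ_{i<k} Λ_i (2 − ℓ_i/a)(Re χ(k_i) cos(ω_n ℓ_i) − Im χ(k_i) sin(ω_n ℓ_i))`.
[cite: Moore1966, Ch. 3 (interval arithmetic: inclusion property)] -/
theorem mem_primeDiagSumC (hS : 0 < S) {ks : List PrimeLen} {C : Consts} (hC : ConstsValid S a ks C)
    (χ : DirichletCharacter ℂ q) {xs ys : List MI}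
    (hx : ∀ i < ks.length, MI.mem S (χ (((ks.getD i default).val : ℕ) : ZMod q)).re (xs.getD i default))
    (hy : ∀ i < ks.length, MI.mem S (χ (((ks.getD i default).val : ℕ) : ZMod q)).im (ys.getD i default))
    {n : ℤ} {R : IdxRec} (hR : OffValid S a ks n R) :
    ∀ k, k ≤ ks.length → MI.mem S (∑ i ∈ Finset.range k,
      (ks.getD i default).wt * (2 - (ks.getD i default).len / a) *
        ((χ (((ks.getD i default).val : ℕ) : ZMod q)).re * Real.cos (freq a n * (ks.getD i default).len) -
          (χ (((ks.getD i default).val : ℕ) : ZMod q)).im * Real.sin (freq a n * (ks.getD i default).len)))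
      (primeDiagSumC S xs ys C.wts C.ws R.cs k)
  | 0, _ => by simpa [primeDiagSumC] using MI.mem_ofInt S 0
  | k + 1, hk => by
      rw [Finset.sum_range_succ, primeDiagSumC]
      have hk' : k < ks.length := hk
      have hcos : MI.mem S (Real.cos (freq a n * (ks.getD k default).len)) (R.cs.getD k default).re := by
        have := (hR.cs k hk').1
        rwa [Complex.exp_ofReal_mul_I_re] at this
      have hsin : MI.mem S (Real.sin (freq a n * (ks.getD k default).len)) (R.cs.getD k default).im := by
        have := (hR.cs k hk').2
        rwa [Complex.exp_ofReal_mul_I_im] at this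
      refine MI.mem_add (mem_primeDiagSumC hS hC χ hx hy hR k (by omega)) ?_
      exact mem_of_eq (MI.mem_mul hS (MI.mem_mul hS (hC.wts k hk') (hC.ws k hk')) (MI.mem_sub
        (MI.mem_mul hS (hx k hk') hcos) (MI.mem_mul hS (hy k hk') hsin))) (by ring)

/-! ## The complex entry box -/

/-- **The complex twisted entry box** for `Re G^χ(n,m)`: diagonal = archimedean part of (5.15) (no polar term) minus the
χ-weighted diagonal prime sum plus `log q`; off-diagonal = `offScale` of `F_m − F_n`.
[cite: Yoshida1992HermitianForms, §5 (5.15)-(5.16) p. 301] -/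
def twistedGramCBox (S : ℕ) (C : Consts) (xs ys : List MI) (LQ : MI) (Rn Rm : IdxRec) (n m : ℤ) : MI :=
  if n = m then
    ((((Rn.reP.sub C.logPi).add ((Rn.rePD.mul S C.invA).divNat 4)).sub (Rn.eD.mul S C.invA)).sub
      (primeDiagSumC S xs ys C.wts C.ws Rn.cs C.wts.length)).add LQ
  else
    offScale S C n m
      ((((Rm.imP.divNat 2).add (primeSumC S xs ys C.wts Rm.cs C.wts.length)).sub Rm.eS).sub
        (((Rn.imP.divNat 2).add (primeSumC S xs ys C.wts Rn.cs C.wts.length)).sub Rn.eS))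

/-- `e^{iθt}` for real `θ`, `t`: real and imaginary parts. -/
private theorem cexp_mul_mul_I_eq (θ t : ℝ) :
    cexp (((θ : ℝ) : ℂ) * t * I) = ((Real.cos (θ * t) : ℝ) : ℂ) + ((Real.sin (θ * t) : ℝ) : ℂ) * I := by
  rw [← Complex.ofReal_mul, Complex.exp_mul_I, ← Complex.ofReal_cos, ← Complex.ofReal_sin]

/-- The diagonal shift term: `2 Re((1 − w)·P_t(n,n)) = (2 − t/a)((1 − Re w) cos(ω_n t) + Im w sin(ω_n t))`. -/
theorem two_mul_re_one_sub_mul_shiftCoeff_diag (ha : a ≠ 0) (t : ℝ) (n : ℤ) (w : ℂ) :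
    2 * ((1 - w) * shiftCoeff a t n n).re =
      (2 - t / a) * ((1 - w.re) * Real.cos (freq a n * t) + w.im * Real.sin (freq a n * t)) := by
  unfold shiftCoeff
  rw [if_pos rfl, cexp_mul_mul_I_eq]
  unfold freq
  simp only [Complex.mul_re, Complex.mul_im, Complex.sub_re, Complex.sub_im, Complex.add_re, Complex.add_im,
    Complex.ofReal_re, Complex.ofReal_im, Complex.I_re, Complex.I_im, Complex.one_re, Complex.one_im]
  field_simp
  ring

/-- **The diagonal of `Re G^χ`**: `Re G^χ(n,n) = archCoeff(n,n) + log q − Σ_k Λ(k)k^{-1/2}(2 − log k/a)(Re χ cos − Im χ sin)(ω_n log k)`.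
[cite: Yoshida1992HermitianForms, §5 (5.15) p. 301] -/
theorem re_twistedGramCoeffC_diag (ha : a ≠ 0) (χ : DirichletCharacter ℂ q) (n : ℤ) :
    (twistedGramCoeffC χ a n n).re = archCoeff a n n + Real.log q -
      ∑ k ∈ weilPrimeIndex a, (Λ k : ℝ) / Real.sqrt k * ((2 - Real.log k / a) *
        ((χ (k : ZMod q)).re * Real.cos (freq a n * Real.log k) - (χ (k : ZMod q)).im * Real.sin (freq a n * Real.log k))) := by
  rw [re_twistedGramCoeffC, if_pos rfl]
  have hG : gramCoeff a n n - polarCoeff a n n = primeCoeff a n n + archCoeff a n n := by unfold gramCoeff; ring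
  have hP : primeCoeff a n n = ∑ k ∈ weilPrimeIndex a, (Λ k : ℝ) / Real.sqrt k * (incrCoeff a (Real.log k) n n - 2) := by
    unfold primeCoeff; simp
  have hsum : primeCoeff a n n + ∑ k ∈ weilPrimeIndex a, (Λ k : ℝ) / Real.sqrt k *
      (2 * ((1 - χ (k : ZMod q)) * shiftCoeff a (Real.log k) n n).re) =
      -(∑ k ∈ weilPrimeIndex a, (Λ k : ℝ) / Real.sqrt k * ((2 - Real.log k / a) *
        ((χ (k : ZMod q)).re * Real.cos (freq a n * Real.log k) - (χ (k : ZMod q)).im * Real.sin (freq a n * Real.log k)))) := by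
    rw [hP, ← Finset.sum_add_distrib, ← Finset.sum_neg_distrib]
    refine Finset.sum_congr rfl fun k _ ↦ ?_
    rw [two_mul_re_one_sub_mul_shiftCoeff_diag ha]
    unfold incrCoeff
    rw [if_pos rfl]
    field_simp
    ring
  linarith [hG, hsum]

/-- ★ **The complex entry box is sound.**  Valid constants, prime data of the window, boxes `xs ∋ Re χ(k_i)`,
`ys ∋ Im χ(k_i)` on the listed prime powers, `log q ∈ LQ`, an off-diagonally valid record at `n` (diagonally valid too
when `n = m`) and one at `m`: `Re G^χ(n,m) ∈ twistedGramCBox S C xs ys LQ Rn Rm n m`.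
[cite: Yoshida1992HermitianForms, §5 (5.15)-(5.16) p. 301] -/
theorem mem_twistedGramCBox (hS : 0 < S) (ha0 : 0 < a) {ks : List PrimeLen} (hks : PrimeData a ks) {C : Consts}
    (hC : ConstsValid S a ks C) (χ : DirichletCharacter ℂ q) {xs ys : List MI}
    (hx : ∀ i < ks.length, MI.mem S (χ (((ks.getD i default).val : ℕ) : ZMod q)).re (xs.getD i default))
    (hy : ∀ i < ks.length, MI.mem S (χ (((ks.getD i default).val : ℕ) : ZMod q)).im (ys.getD i default))
    {LQ : MI} (hLQ : MI.mem S (Real.log q) LQ) {n m : ℤ} {Rn Rm : IdxRec}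
    (hn : OffValid S a ks n Rn) (hnd : n = m → DiagValid S a n Rn) (hm : OffValid S a ks m Rm) :
    MI.mem S ((twistedGramCoeffC χ a n m).re) (twistedGramCBox S C xs ys LQ Rn Rm n m) := by
  unfold twistedGramCBox
  by_cases hnm : n = m
  · -- diagonal
    subst hnm
    have hd := hnd rfl
    rw [if_pos rfl, re_twistedGramCoeffC_diag ha0.ne' χ n]
    -- prime sum over the window as a range sum over the prime data
    have hlist := sum_weilPrimeIndex_eq_listSum hks (fun k ↦ (2 - Real.log k / a) *
      ((χ (k : ZMod q)).re * Real.cos (freq a n * Real.log k) - (χ (k : ZMod q)).im * Real.sin (freq a n * Real.log k)))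
    rw [list_sum_map_eq_sum_range] at hlist
    simp only [PrimeLen.log_val] at hlist
    have hpri : MI.mem S (∑ k ∈ weilPrimeIndex a, (Λ k : ℝ) / Real.sqrt k * ((2 - Real.log k / a) *
        ((χ (k : ZMod q)).re * Real.cos (freq a n * Real.log k) - (χ (k : ZMod q)).im * Real.sin (freq a n * Real.log k))))
        (primeDiagSumC S xs ys C.wts C.ws Rn.cs C.wts.length) := by
      rw [hlist, hC.wts_len]
      refine mem_of_eq (mem_primeDiagSumC hS hC χ hx hy hn ks.length le_rfl) ?_
      refine Finset.sum_congr rfl fun i _ ↦ ?_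
      ring
    have harch : MI.mem S (archCoeff a n n)
        (((Rn.reP.sub C.logPi).add ((Rn.rePD.mul S C.invA).divNat 4)).sub (Rn.eD.mul S C.invA)) := by
      unfold archCoeff
      simp only [if_true]
      have h := MI.mem_sub (MI.mem_add (MI.mem_sub hd.reP hC.logPi)
        (MI.mem_divNat (MI.mem_mul hS hd.rePD hC.invA) (n := 4) (by norm_num))) (MI.mem_mul hS hd.eD hC.invA)
      refine mem_of_eq h ?_
      have ha' : a ≠ 0 := ha0.ne'
      push_cast
      field_simp
    exact mem_of_eq (MI.mem_add (MI.mem_sub harch hpri) hLQ) (by ring)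
  · -- off the diagonal: `(−1)^{n+m}(F_m − F_n)/(π(m−n))`
    rw [if_neg hnm, re_twistedGramCoeffC_offDiag χ a hnm]
    have hF : ∀ {p : ℤ} {R : IdxRec}, OffValid S a ks p R →
        MI.mem S ((Complex.digamma (1 / 4 + ((freq a p : ℝ) : ℂ) / 2 * I)).im / 2
          + (∑ k ∈ weilPrimeIndex a, (Λ k : ℝ) / Real.sqrt k *
              ((χ (k : ZMod q)).re * Real.sin (freq a p * Real.log k) + (χ (k : ZMod q)).im * Real.cos (freq a p * Real.log k)))
          - archExpSumSin a p)
          (((R.imP.divNat 2).add (primeSumC S xs ys C.wts R.cs C.wts.length)).sub R.eS) := by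
      intro p R hR
      have hlist := sum_weilPrimeIndex_eq_listSum hks (fun k ↦
        (χ (k : ZMod q)).re * Real.sin (freq a p * Real.log k) + (χ (k : ZMod q)).im * Real.cos (freq a p * Real.log k))
      rw [list_sum_map_eq_sum_range] at hlist
      simp only [PrimeLen.log_val] at hlist
      have hpri : MI.mem S (∑ k ∈ weilPrimeIndex a, (Λ k : ℝ) / Real.sqrt k *
          ((χ (k : ZMod q)).re * Real.sin (freq a p * Real.log k) + (χ (k : ZMod q)).im * Real.cos (freq a p * Real.log k)))
          (primeSumC S xs ys C.wts R.cs C.wts.length) := by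
        rw [hlist, hC.wts_len]
        exact mem_primeSumC hS hC χ hx hy hR ks.length le_rfl
      exact mem_of_eq (MI.mem_sub (MI.mem_add (MI.mem_divNat hR.imP (n := 2) (by norm_num)) hpri) hR.eS)
        (by push_cast; ring)
    refine mem_of_eq (mem_offScale hS hC hnm (MI.mem_sub (hF hm) (hF hn))) ?_
    have hπ : (π : ℝ) ≠ 0 := Real.pi_ne_zero
    have hmn : ((m : ℝ) - n) ≠ 0 := sub_ne_zero.mpr (by exact_mod_cast (Ne.symm hnm))
    have hnm' : ((n : ℝ) - m) ≠ 0 := sub_ne_zero.mpr (by exact_mod_cast hnm)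
    field_simp
    ring

end TwistedEncl

end Summit.Ventures.WeilGRH

/-! ### Build note
weil-grh-2 gen11, 2026-08-24 (lead R14-3 APPEND REMEDY): append-only re-commit of the file accepted as p374915 (2026-08-24T02:42Z) so that the hub
builder produces its olean (no olean 7 h after acceptance; importer probes answer `remote:stale:…:unbuilt`).  No declaration is added or changed. -/
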